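import Summits.Ventures.GridStability.Models.InverterPLL
import Summits.Ventures.GridStability.Models.SMIB

/-!
# GridStability/Models/InverterPLLRecast — the PLL «generalized swing equation» in the cell's certificate vocabulary (deviation-coordinate `SOS.Poly` recast, interface I2)

Cell `gridfusion` (LADDER-GRIDFUSION, rung G3 «inverter models» = APEX LINE, director RULINGS 3 (1);
seat model-3; `plan/PARTITION.md` §0 row `Models/`, A1 (deviation coordinates, REDEFINED rational
equilibrium data), A12). THREE COLUMNS: MODELLED column — an exact change of variables and the
chain rule for the printed model `InverterPLL.GenSwing` (p459482); no stability claim.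

## Why this file

Among the typed inverter models the PLL-based converter's generalized swing equation
[cite: DuEtAl2024, Eq. (1)] `θ̇ = ω`, `ω̇ = I − sin θ − (α cos θ − D) ω` (after [cite: MaEtAl2022])
is the cheapest object on the apex line that is NOT a classical machine model: its damping
`α cos θ − D` is STATE-DEPENDENT («different from the classical swing models in which the damping
coefficient is a constant» [cite: DuEtAl2024, text after Eq. (1)]), the classical energy function is
not a Lyapunov function where `α cos θ < D` (`GenSwing.energy_deriv`), and the source's whole subject
is the SHAPE OF THE ATTRACTING BASIN («fishlike pattern», coexisting attractors, inferred there by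
reservoir computing from time series, printed parameters `(I, D, α) = (0.4, 0.39, 0.7)`
[corpus:paper:galaxy-pdf-797454286265273120 chunk p0006 = PRR 6, 013181 (2024) §II, Fig. 1(a)];
`D = 0.06` variant, Fig. 5). A kernel-checked SOS inner estimate of that basin is therefore a
certified statement where print offers simulation / machine learning — and it costs EXACTLY an
SMIB run: the recast below has the same three variables `(σ, κ, ω)`, the same constraint
`SMIB.hcon`, the same embedding `SMIB.embed`, and a field that differs from `SMIB.polyField` by two
bilinear monomials (`κω`, `σω`). Gram sizes = SMIB's (10 / 20 / 35 at `V`-degree 2 / 4 / 6);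
toolchains A/B and sos-5's emitter apply unchanged (rung proposal «G3.d PLL-swing», MODEL-3-NOTES §4).

## The recast (deviation coordinates, A1)

`u = θ − θ^s`, `z = (σ, κ, ω) = (sin u, 1 − cos u, ω)` (= `SMIB.embed θ^s (θ, ω)`), rational
circle point `(s^*, c^*) = (sin θ^s, cos θ^s)` and the input power REDEFINED as `I′ := s^*`
(so that `θ^s` is an exact equilibrium: `GenSwing.equilibrium_iff`; recipe as for SMIB: half-angle
tangent `t ∈ ℚ`, `s^* = 2t/(1+t²)`, `c^* = (1−t²)/(1+t²)`; for the printed `I = 0.4` the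
A1″-compliant choice `t = 115/551` gives `s^* = 63365/158413`, `|I′ − I| ≈ 1.3·10⁻⁶` — typed below as
the instance proposal `duI04`; the data decision of record is model-4's).
With `sin θ = σ c^* + (1 − κ) s^*`, `cos θ = (1 − κ) c^* − σ s^*`:
  `σ̇ = (1 − κ) ω` (`SMIB.fσ`),  `κ̇ = σ ω` (`SMIB.fκ`),
  `ω̇ = −c^* σ + s^* κ − (α c^* − D) ω + α c^* κ ω + α s^* σ ω`  (`GenSwing.fω`),
  `h = σ² + κ² − 2κ = 0` (`SMIB.hcon`).
MODELLED: MODEL-VALIDITY MV-6P (grid-following converter, SRF-PLL reduced model; dimensionless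
normalisation of [cite: MaEtAl2022] as used by [cite: DuEtAl2024]); `M′` = the model with `I′`.
-/

noncomputable section

open Real
open Literature.Computation.Certificates
open Literature.Computation.Certificates.SOS

namespace Summit.Ventures.GridStability.Models.InverterPLL.GenSwing

variable (G : GenSwing)

/-- Recast `ω̇`-component of the generalized swing equation in the deviation variables
`z = (σ, κ, ω) ↦ (0, 1, 2)` with RATIONAL data `c^* = cos θ^s`, `s^* = sin θ^s = I′`, `α`, `D`:
`f_ω = −c^* σ + s^* κ − (α c^* − D) ω + α c^* κω + α s^* σω` [cite: DuEtAl2024, Eq. (1)] under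
`sin θ = σ c^* + (1−κ) s^*`, `cos θ = (1−κ) c^* − σ s^*`. Degree 2; the last two monomials are the
state-dependent damping. -/
def fω (cs ss α D : ℚ) : Poly :=
  [(([1] : List ℕ), -cs), (([0, 1] : List ℕ), ss), (([0, 0, 1] : List ℕ), -(α * cs - D)),
    (([0, 1, 1] : List ℕ), α * cs), (([1, 0, 1] : List ℕ), α * ss)]

/-- The recast PLL generalized-swing field `f = (f_σ, f_κ, f_ω)` as a list of `SOS.Poly`
(interface I2): the two kinematic components are model-1's `SMIB.fσ`, `SMIB.fκ` verbatim; the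
constraint is `SMIB.hcon`; `f(0) = 0` coefficientwise. -/
def polyField (cs ss α D : ℚ) : List Poly := [SMIB.fσ, SMIB.fκ, fω cs ss α D]

/-- **Faithfulness of the recast `ω̇`.** If `(cs, ss) = (cos θ^s, sin θ^s)`, `α, D` are the
model's coefficients and `I = sin θ^s` (the REDEFINED `I′` of A1), then on the image of
`SMIB.embed θ^s` the polynomial `f_ω` evaluates to the printed `ω̇ = I − sin θ − (α cos θ − D) ω`
(sine/cosine addition formulas; exact). -/
theorem fω_eval_embed {cs ss α D : ℚ} {θs : ℝ} (hc : (cs : ℝ) = cos θs) (hs : (ss : ℝ) = sin θs)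
    (hα : (α : ℝ) = G.α) (hD : (D : ℝ) = G.D) (hI : G.I = sin θs) (x : ℝ × ℝ) :
    (fω cs ss α D).eval (SMIB.embed θs x) = G.dω x.1 x.2 := by
  simp only [fω, SMIB.embed, GenSwing.dω, Poly.eval_cons, Poly.eval_nil, Monomial.eval_eq,
    Monomial.evalFrom_cons, Monomial.evalFrom_nil, vars_cons_zero, vars_cons_succ]
  push_cast
  rw [hc, hs, hα, hD, hI]
  have h1 : sin x.1 = sin (x.1 - θs) * cos θs + cos (x.1 - θs) * sin θs := by
    rw [← Real.sin_add]; congr 1; ring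
  have h2 : cos x.1 = cos (x.1 - θs) * cos θs - sin (x.1 - θs) * sin θs := by
    rw [← Real.cos_add]; congr 1; ring
  rw [h1, h2]
  ring

/-- The recast field vanishes at the origin (the equilibrium `(θ^s, 0)` is mapped to `z = 0` by
`SMIB.embed_equilibrium`): every component of `polyField` evaluates to `0` at `z = 0`. -/
theorem polyField_eval_zero (cs ss α D : ℚ) (k : Fin 3) :
    (((polyField cs ss α D).getD k []).eval fun _ => (0 : ℝ)) = 0 := by
  fin_cases k <;>
    simp [polyField, fω, SMIB.fσ, SMIB.fκ, Poly.eval_cons, Poly.eval_nil, Monomial.eval_eq,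
      Monomial.evalFrom_cons, Monomial.evalFrom_nil]

/-- **Exact embedding lemma (chain rule) for the PLL generalized swing equation.** Along every
solution `(θ, ω)` of `GenSwing` (derivatives at all times), the recast curve
`t ↦ z(t) = SMIB.embed θ^s (θ t, ω t)` satisfies `dz_k/dt = f_k(z(t))` within any time set `s`,
`f = polyField cs ss α D`, `k = 0, 1, 2` — under the data relations of `fω_eval_embed`. Hence for a
polynomial `V`, `d/dt V(z(t)) = (∇V·f)(z(t))` on `{SMIB.hcon = 0}`: an SOS certificate produced for
`(polyField, SMIB.hcon)` by the SMIB programme is a certificate about this inverter MODEL, and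
lyap-1's `Lyapunov/CertificateSoundness` applies with the same obligations as for SMIB.
MODELLED: MV-6P. -/
theorem hasDerivWithinAt_embed {cs ss α D : ℚ} {θs : ℝ} (hc : (cs : ℝ) = cos θs)
    (hs : (ss : ℝ) = sin θs) (hα : (α : ℝ) = G.α) (hD : (D : ℝ) = G.D) (hI : G.I = sin θs)
    {θ ω : ℝ → ℝ} (h : G.IsSolution θ ω) {s : Set ℝ} {t : ℝ} (_ht : t ∈ s) (k : Fin 3) :
    HasDerivWithinAt (fun τ => SMIB.embed θs (θ τ, ω τ) k)
      (((polyField cs ss α D).getD k []).eval (SMIB.embed θs (θ t, ω t))) s t := by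
  have hθ : HasDerivAt θ (ω t) t := by simpa [GenSwing.dθ] using h.angle t
  have hω : HasDerivAt ω (G.dω (θ t) (ω t)) t := h.freq t
  have h1 : HasDerivAt (fun τ => θ τ - θs) (ω t) t := hθ.sub_const θs
  fin_cases k
  · -- σ = sin u
    simp only [polyField, List.getD_cons_zero, SMIB.fσ_eval_embed]
    simpa [SMIB.embed, mul_comm] using h1.sin.hasDerivWithinAt
  · -- κ = 1 - cos u
    simp only [polyField, List.getD_cons_succ, List.getD_cons_zero, SMIB.fκ_eval_embed]
    have := (h1.cos).const_sub 1
    simpa [SMIB.embed, mul_comm] using this.hasDerivWithinAt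
  · -- ω
    simp only [polyField, List.getD_cons_succ, List.getD_cons_zero,
      G.fω_eval_embed hc hs hα hD hI]
    simpa [SMIB.embed] using hω.hasDerivWithinAt

/-- The recast constraint holds identically along the recast curve (model-1's
`SMIB.hcon_eval_embed`, restated for PLL solutions' states). -/
theorem hcon_eval_embed (θs : ℝ) (x : ℝ × ℝ) : SMIB.hcon.eval (SMIB.embed θs x) = 0 :=
  SMIB.hcon_eval_embed θs x

/-- **Where SOS beats the energy function.** In the recast variables the state-dependent damping
reads `α cos θ − D = α((1 − κ) c^* − σ s^*) − D`; the printed energy `ω²/2 − Iθ − cos θ` decreases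
along solutions only where this is `≥ 0` (`GenSwing.energy_deriv`). This lemma records the exact
polynomial form of the damping on the embedding, for the memo's lever table (a certificate domain
`D` must either stay inside `{α((1−κ)c^* − σ s^*) ≥ D}` for quadratic-in-`ω` `V`, or use higher
degree). -/
theorem damping_eval_embed {θs : ℝ} (x : ℝ × ℝ) :
    G.α * cos x.1 - G.D
      = G.α * ((1 - SMIB.embed θs x 1) * cos θs - SMIB.embed θs x 0 * sin θs) - G.D := by
  simp only [SMIB.embed_zero, SMIB.embed_one]
  have h2 : cos x.1 = cos (x.1 - θs) * cos θs - sin (x.1 - θs) * sin θs := by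
    rw [← Real.cos_add]; congr 1; ring
  rw [h2]
  ring

/-! ## Instance proposal «PLLSWING-Du-I04» (printed parameters, A1″ equilibrium representation) -/

/-- The printed parameter set of [cite: DuEtAl2024, §II text to Fig. 1(a)] `(I, D, α) = (0.4, 0.39, 0.7)`
[corpus:paper:galaxy-pdf-797454286265273120 chunk p0006], with the input power REDEFINED per
PARTITION A1″ to the rational circle point `t = 115/551`: `I′ = s* = 63365/158413`
(`|I′ − 0.4| ≈ 1.3·10⁻⁶ < 5·10⁻⁶`), `D = 39/100`, `α = 7/10`. Instance id proposed to model-4 /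
sos-3: «PLLSWING-Du-I04» (data custody model-4; this record is the typed mirror). MODELLED:
MV-6P + MV-P. -/
def duI04 : GenSwing where
  I := 63365 / 158413
  D := 39 / 100
  α := 7 / 10

/-- Equilibrium angle of record `θ^s = arcsin(63365/158413)`. -/
def duI04_θs : ℝ := arcsin (63365 / 158413)

/-- `sin θ^s = s* = 63365/158413 = I′`. -/
theorem sin_duI04_θs : sin duI04_θs = 63365 / 158413 := by
  unfold duI04_θs
  rw [sin_arcsin] <;> norm_num

/-- `cos θ^s = c* = 145188/158413` (exact circle point: `63365² + 145188² = 158413²`). -/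
theorem cos_duI04_θs : cos duI04_θs = 145188 / 158413 := by
  unfold duI04_θs
  rw [cos_arcsin]
  have h : (1 : ℝ) - (63365 / 158413) ^ 2 = (145188 / 158413) ^ 2 := by norm_num
  rw [h, sqrt_sq]
  norm_num

namespace duI04

/-- Data relation `cs = cos θ^s`. -/
theorem rel_c : ((145188 / 158413 : ℚ) : ℝ) = cos duI04_θs := by rw [cos_duI04_θs]; norm_num
/-- Data relation `ss = sin θ^s`. -/
theorem rel_s : ((63365 / 158413 : ℚ) : ℝ) = sin duI04_θs := by rw [sin_duI04_θs]; norm_num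
/-- Data relation `α = 7/10`. -/
theorem rel_α : ((7 / 10 : ℚ) : ℝ) = duI04.α := by norm_num [duI04]
/-- Data relation `D = 39/100`. -/
theorem rel_D : ((39 / 100 : ℚ) : ℝ) = duI04.D := by norm_num [duI04]
/-- The REDEFINED input power is the equilibrium sine: `I′ = sin θ^s` (eq=b exact). -/
theorem rel_I : duI04.I = sin duI04_θs := by rw [sin_duI04_θs]; norm_num [duI04]

/-- `(θ^s, 0)` is an equilibrium of the instance. -/
theorem isEquilibrium : duI04.dθ duI04_θs 0 = 0 ∧ duI04.dω duI04_θs 0 = 0 :=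
  (duI04.equilibrium_iff duI04_θs 0).2 ⟨rfl, rel_I.symm⟩

/-- Local damping at the equilibrium is positive: `α c* − D = 3985053/15841300 > 0` (≈ 0.2516); the
state-dependent damping `α cos θ − D` turns NEGATIVE for `cos θ < D/α = 39/70` — the region where
the printed energy function fails and an SOS certificate has to work. -/
theorem damping_at_equilibrium : duI04.α * cos duI04_θs - duI04.D = 3985053 / 15841300 := by
  rw [cos_duI04_θs]; norm_num [duI04]

/-- **Interface I2 for rung G3.d, instantiated (hypothesis-free chain rule).** Along every solution
of «PLLSWING-Du-I04», the recast curve `z(t) = SMIB.embed θ^s (θ t, ω t)` satisfies `dz_k/dt = f_k(z)`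
with `f = GenSwing.polyField (145188/158413) (63365/158413) (7/10) (39/100)` on `{SMIB.hcon = 0}`
— the exact object the SMIB programme (toolchains A/B, sos-5 emitter, lyap-1 soundness) consumes. -/
theorem embed_hasDerivWithinAt {θ ω : ℝ → ℝ} (h : duI04.IsSolution θ ω) {s : Set ℝ} {t : ℝ}
    (ht : t ∈ s) (k : Fin 3) :
    HasDerivWithinAt (fun τ => SMIB.embed duI04_θs (θ τ, ω τ) k)
      (((GenSwing.polyField (145188 / 158413) (63365 / 158413) (7 / 10) (39 / 100)).getD k []).eval
        (SMIB.embed duI04_θs (θ t, ω t))) s t :=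
  GenSwing.hasDerivWithinAt_embed duI04 rel_c rel_s rel_α rel_D rel_I h ht k

end duI04

end Summit.Ventures.GridStability.Models.InverterPLL.GenSwing

end
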